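import Summits.QuantumFields.YangMills.Theorems.FluctuationComparisonRegPrIntLS2BetaRelativeOneLevelStepBkg
import Summits.QuantumFields.YangMills.Theorems.FluctuationComparisonRegPrIntLS2BetaBondNeighbourhoodKernel
import Summits.QuantumFields.YangMills.Theorems.FluctuationComparisonRegPrIntLS2BetaCorrLetterL2Relative
import Summits.QuantumFields.YangMills.Theorems.FluctuationComparisonRegPrIntLS2BetaKeyLemmaSkeleton
import HarnessLib

/-!
# S2β · letter (D♮)∕(D-stage) REL-TEL, the (C)-half — THE RELATIVE `hstep` ∕ `hj` PAIR OF ONE LEVEL, BACKGROUND-PRICED (relative twin of ✓`…S2BetaOneLevelStep.hstep_hj`,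
# docking on ✓p823396 `relKeyLemma_level` ∕ px12 g24's (H♭♭) row: MAIN coefficient `1 + 26·((d+2)L)²θ` (history), SOURCE `ε·‖f‖₂ + η` with `ε, η ∝ (BKG θ₀ + supRel β♯)`)

Cell `ym3-torus` (rung R3 = continuum `SU(2)` Yang–Mills on the three-torus — NOT d = 4, NOT infinite volume, NOT a mass gap, NOT Clay).
Width seat «width 10» `ym3-torus-px10` (gen 23), FREE px helper on crux `stmt-QuantumFields-20520`, count-neutral, DEFINITION-FREE; own-risk brick of the px10 lane
«(C)-half of letter (D♮)» (UV3-NODE §82).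

WHAT.  ✓∕⧗`relOneLevelStep_bkg` bounds the relative coarse plaquette `f′ Q := dist1 (Ū₀(∂Q)⁻¹Ū(∂Q))` by
`(1 + 26·((d+2)L)²θ)·Σ_p K Q p·f p + 1.5·10⁶·((d+2)L)²θ₀·β + 1.1·10⁷·β² + 5L³θ₀·γ` (`θ` = the FIELD's history threshold, `θ₀ ≤ θ` = the BACKGROUND's size) with
`f p := dist1 (U₀(∂p)⁻¹U(∂p))` and LOCAL RELATIVE DATA `β` (member loops ∕ axial ∕ staircase transports at `Q`) and `γ` (forward-near bond deviations).  Here the data are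
read from the bond function `g c := dist1 (U₀(c)⁻¹U(c))` and `f`: `γ(Q) := Σ_{c fwd-near Q₋} g c` (✓BRICK 3's kernel), `β(Q) ≤ β♯` (an A-PRIORI sup bound — supRel; it
linearises the genuine quadratic junk: `β² ≤ β♯·β`) and `β(Q) ≤ cβ·Σ_{c near Q₋} g c + cε·Σ_{q near Q₋} f q` over the `3^d`-block neighbourhoods (the SUPPLIER SHAPE —
px21 g23's ✓p823652 `dist1_loopHol_rel_le_local` delivers it; a HYPOTHESIS here).  Then (§1: the `3^d`-neighbourhood BOND kernel — rows `≤ 3^dL^dd` (px21 g23 ✓p824227 `card_bond_nbhd3_le`, reused),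
columns `≤ 3^dd²`, Schur; plaquettes: ✓p817170 `nbhd_schur`) ★★★ `relHstep_hj_bkg`: (hstep) `∀ Q, f′ Q ≤ (1 + 26·((d+2)L)²θ)·Σ_p K Q p·f p + j Q` and (hj) `√Σ_Q (j Q)² ≤ ε·√Σ_q (f q)² + η`
with `κ := 1.5·10⁶·((d+2)L)²θ₀ + 1.1·10⁷·β♯`, `ε := κ·cε·√((3^dL^dd²)(3^dd²))`, `η := (κ·cβ + 5L³θ₀)·√((3^dL^dd)(3^dd²))·√Σ_c (g c)²` — ✓`relKeyLemma_level`'s `hj`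
input, every coefficient of the source priced by BKG + supRel (px12 g24 ‼ 13:07:55Z ∕ 13:12:09Z: `W j u = c·SIZE_u·(…)`).

HONEST SCOPE.  Counting + packaging over landed∕signed letters; nothing of Bałaban's asserted; the supplier `cβ, cε`, the sup-profile `β♯`, the BKG-tower letter, the
level-indexed tower on the T³ record, (H♭♭), (D-stage), GAP♯∘ (`stub_uniformFibreGapOrbit`), S2β, crux 20520 and `YM3TorusSU2` are NOT proved; no registered stub is closed;
the Yang–Mills mass gap is NOT proved.  Sorry-free, axioms standard.
References: T. Bałaban, CMP **99** (1985) 75–102 [Balaban1985RegularSpaces] (Lemma 1 p.79); CMP **109** (1987) 249–301 [Balaban1987RG1] ((0.1)–(0.4) pp.252–253).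
-/

set_option autoImplicit false

noncomputable section

namespace Summit.QuantumFields.YangMills.Theorems.FluctuationComparisonRegPrIntLS2BetaRelativeHstepHjBkg

open NormedSpace Finset
open scoped BigOperators
open Literature.MathematicalPhysics.QuantumFieldTheory.Balaban1983to89
open Literature.MathematicalPhysics.QuantumFieldTheory.Balaban1983to89.T4Continuum
open Literature.MathematicalPhysics.QuantumFieldTheory.Balaban1983to89.AveragingRT
open Literature.MathematicalPhysics.QuantumFieldTheory.Balaban1983to89.BlockAveraging
open Literature.MathematicalPhysics.QuantumFieldTheory.Balaban1983to89.ExpMeanLog (expMeanLogSU deltaSU)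
open Literature.MathematicalPhysics.QuantumFieldTheory.Balaban1983to89.T4TiltOscillation (bdev)
open B10Eq47AxialChi (shiftN)
open Summit.QuantumFields.YangMills.Theorems.FluctuationComparisonRegPrIntLS2BetaSchurTest (schur_test_sq)
open Summit.QuantumFields.YangMills.Theorems.FluctuationComparisonRegPrIntLS2BetaNeighbourhoodKernelTorus (card_near_le card_filter_src_mem_le near_symm)
open Summit.QuantumFields.YangMills.Theorems.FluctuationComparisonRegPrIntLS2BetaBondNeighbourhoodKernel (card_bond_filter_blockOf_mem_le fineBond_nbhd_schur)
open Summit.QuantumFields.YangMills.Theorems.FluctuationComparisonRegPrIntLS2BetaCorrLetterL2Relative (card_bond_nbhd3_le)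
open Summit.QuantumFields.YangMills.Theorems.FluctuationComparisonRegPrIntLS2BetaRelativeOneLevelStepBkg (relOneLevelStep_bkg)

variable {P : Params} {j k : ℕ}

/-! ## §1 The `3^d`-neighbourhood bond kernel: counts and Schur -/

/-- ★ **COLUMN COUNT** (`3^d`-neighbourhood, bonds): a fine bond lies in the neighbourhood of at most `3^d·d²` coarse plaquettes. [cite: Balaban1987RG1, (0.3) p.252] -/
theorem card_bond_conbhd3_le (c : PBond P j) :
    (Finset.univ.filter (fun Q : Plaq P (j + 1) => ∀ κ, blockOf c.src κ = Q.src κ ∨ blockOf c.src κ = Q.src κ + 1 ∨ blockOf c.src κ = Q.src κ - 1)).card ≤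
      3 ^ P.d * P.d ^ 2 := by
  classical
  set S := Finset.univ.filter (fun z : Site P (j + 1) => ∀ κ, z κ = blockOf c.src κ ∨ z κ = blockOf c.src κ + 1 ∨ z κ = blockOf c.src κ - 1) with hS
  have hsub : Finset.univ.filter (fun Q : Plaq P (j + 1) => ∀ κ, blockOf c.src κ = Q.src κ ∨ blockOf c.src κ = Q.src κ + 1 ∨ blockOf c.src κ = Q.src κ - 1) ⊆
      Finset.univ.filter (fun Q : Plaq P (j + 1) => Q.src ∈ S) := by
    intro Q hQ
    rw [Finset.mem_filter] at hQ ⊢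
    refine ⟨hQ.1, ?_⟩
    rw [hS, Finset.mem_filter]
    exact ⟨Finset.mem_univ _, near_symm hQ.2⟩
  exact (Finset.card_le_card hsub).trans ((card_filter_src_mem_le S).trans (Nat.mul_le_mul_right _ (card_near_le _)))

/-- ★★ **SCHUR FOR THE `3^d`-NEIGHBOURHOOD BOND KERNEL**: `Σ_Q (Σ_{c near Q₋} g c)² ≤ (3^dL^dd)(3^dd²)·Σ_c (g c)²`. [cite: Balaban1985Averaging, (19) p.21] -/
theorem fineBond_nbhd3_schur (hj : j + 1 ≤ P.m + P.K) (g : PBond P j → ℝ) :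
    ∑ Q : Plaq P (j + 1), (∑ c ∈ Finset.univ.filter (fun c : PBond P j => ∀ κ, blockOf c.src κ = Q.src κ ∨ blockOf c.src κ = Q.src κ + 1 ∨
        blockOf c.src κ = Q.src κ - 1), g c) ^ 2 ≤
      ((3 ^ P.d * P.L ^ P.d * P.d : ℕ) : ℝ) * ((3 ^ P.d * P.d ^ 2 : ℕ) : ℝ) * ∑ c : PBond P j, g c ^ 2 := by
  classical
  have h := schur_test_sq (Finset.univ : Finset (Plaq P (j + 1))) (Finset.univ : Finset (PBond P j))
    (fun Q c => if (∀ κ, blockOf c.src κ = Q.src κ ∨ blockOf c.src κ = Q.src κ + 1 ∨ blockOf c.src κ = Q.src κ - 1) then (1 : ℝ) else 0)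
    (fun Q _ c _ => by positivity) (R := ((3 ^ P.d * P.L ^ P.d * P.d : ℕ) : ℝ)) (C := ((3 ^ P.d * P.d ^ 2 : ℕ) : ℝ)) (by positivity)
    (fun Q _ => by
      rw [← Finset.sum_filter, Finset.sum_const, nsmul_eq_mul, mul_one]
      exact_mod_cast card_bond_nbhd3_le hj Q.src)
    (fun c _ => by
      rw [← Finset.sum_filter, Finset.sum_const, nsmul_eq_mul, mul_one]
      exact_mod_cast card_bond_conbhd3_le c) g
  simp only [ite_mul, one_mul, zero_mul, Finset.sum_ite, Finset.sum_const_zero, add_zero] at h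
  convert h using 4

/-! ## §2 The relative `hstep` ∕ `hj` pair -/

variable {n : Type*} [Fintype n] [DecidableEq n] [Nonempty n]

/-- ★★★ **THE RELATIVE `hstep` ∕ `hj` PAIR OF ONE (0.4) AVERAGING WITH `exp[mean log]` ON `SU(N)`, BACKGROUND-PRICED** (standing range; `PlaqSmall θ U` with
`((d+2)L)²θ ≤ 1∕800`, `((d+2)L)²∕4·θ < δ_N`; `PlaqSmall θ₀ U₀`, `0 ≤ θ₀ ≤ θ`): with `f p := dist1 (U₀(∂p)⁻¹U(∂p))`, `f′ Q := dist1 (Ū₀(∂Q)⁻¹Ū(∂Q))`, the bond function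
`g c := dist1 (U₀(c)⁻¹U(c))`, and a LOCAL RELATIVE DATUM `β : Plaq_{j+1} → ℝ≥0` bounding the relative member loops ∕ axial ∕ staircase transports at each `Q`, with an a-priori
sup `0 ≤ β Q ≤ β♯ ≤ 1∕6400` and SUPPLIED by the `3^d`-neighbourhood (`β Q ≤ cβ·Σ_{c near Q₋} g c + cε·Σ_{q near Q₋} f q`, `0 ≤ cβ, cε`):
(hstep) `∀ Q, f′ Q ≤ (1 + 26·((d+2)L)²θ)·Σ_p K Q p·f p + j Q`, `j Q := κ·β Q + 5L³θ₀·Σ_{c fwd-near Q₋} g c`, `κ := 1.5·10⁶·((d+2)L)²θ₀ + 1.1·10⁷·β♯`;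
(hj) `√Σ_Q (j Q)² ≤ κ·cε·√((3^dL^dd²)(3^dd²))·√Σ_q (f q)² + (κ·cβ + 5L³θ₀)·√((3^dL^dd)(3^dd²))·√Σ_c (g c)²` — the `ε‖f‖₂ + η` source of ✓`relKeyLemma_level`.
[cite: Balaban1985RegularSpaces, Lemma 1 p.79] -/
theorem relHstep_hj_bkg (hj : j + 1 ≤ P.m + P.K) (U U₀ : GaugeField P j (Matrix.specialUnitaryGroup n ℂ)) {θ θ₀ : ℝ} (hθ00 : 0 ≤ θ₀) (hθ₀θ : θ₀ ≤ θ)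
    (hθ : (((P.d + 2) * P.L : ℕ) : ℝ) ^ 2 * θ ≤ 1 / 800) (hδ : (((P.d + 2) * P.L : ℕ) : ℝ) ^ 2 / 4 * θ < deltaSU n)
    (hU : PlaqSmall θ U) (hU₀ : PlaqSmall θ₀ U₀) (β : Plaq P (j + 1) → ℝ) (hβ0 : ∀ Q, 0 ≤ β Q) {βs cβ cε : ℝ} (hβs0 : 0 ≤ βs) (hβsup : ∀ Q, β Q ≤ βs)
    (hβs : βs ≤ 1 / 6400) (hcβ : 0 ≤ cβ) (hcε : 0 ≤ cε)
    (hW : ∀ (Q : Plaq P (j + 1)) (c : PBond P (j + 1)), (c = ⟨Q.src, Q.μ⟩ ∨ c = ⟨Q.src.shift Q.μ, Q.ν⟩ ∨ c = ⟨Q.src.shift Q.ν, Q.μ⟩ ∨ c = ⟨Q.src, Q.ν⟩) →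
      ∀ i, dist1 ((loopHol U₀ c i)⁻¹ * loopHol U c i) ≤ β Q)
    (hA : ∀ (Q : Plaq P (j + 1)) (c : PBond P (j + 1)), (c = ⟨Q.src, Q.μ⟩ ∨ c = ⟨Q.src.shift Q.μ, Q.ν⟩ ∨ c = ⟨Q.src.shift Q.ν, Q.μ⟩ ∨ c = ⟨Q.src, Q.ν⟩) →
      dist1 ((axialAvg U₀ c)⁻¹ * axialAvg U c) ≤ β Q)
    (hS : ∀ (Q : Plaq P (j + 1)) (i : Idx P),
      dist1 ((holAt U₀ (walk (emb Q.src) (stairWord i.2.1 (off i.1))))⁻¹ * holAt U (walk (emb Q.src) (stairWord i.2.1 (off i.1)))) ≤ β Q)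
    (hβ : ∀ Q : Plaq P (j + 1), β Q ≤ cβ * ∑ c ∈ Finset.univ.filter (fun c : PBond P j => ∀ κ, blockOf c.src κ = Q.src κ ∨ blockOf c.src κ = Q.src κ + 1 ∨
      blockOf c.src κ = Q.src κ - 1), dist1 (bdev U U₀ c) +
      cε * ∑ q ∈ Finset.univ.filter (fun q : Plaq P j => ∀ κ, blockOf q.src κ = Q.src κ ∨ blockOf q.src κ = Q.src κ + 1 ∨
      blockOf q.src κ = Q.src κ - 1), dist1 ((GaugeField.plaqHol U₀ q)⁻¹ * GaugeField.plaqHol U q)) :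
    (∀ Q : Plaq P (j + 1), dist1 ((GaugeField.plaqHol (avgFun (expMeanLogSU (n := n)) U₀) Q)⁻¹ * GaugeField.plaqHol (avgFun (expMeanLogSU (n := n)) U) Q) ≤
      (1 + 26 * ((((P.d + 2) * P.L : ℕ) : ℝ) ^ 2 * θ)) *
          ∑ p : Plaq P j, ((P.L : ℝ) ^ P.d)⁻¹ * (((block Q.src).filter (fun x : Site P j => p.μ = Q.μ ∧ p.ν = Q.ν ∧
            ∃ a ∈ range P.L, ∃ b ∈ range P.L, p.src = shiftN (shiftN x Q.μ a) Q.ν b)).card : ℝ) *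
            dist1 ((GaugeField.plaqHol U₀ p)⁻¹ * GaugeField.plaqHol U p) +
        ((1500000 * ((((P.d + 2) * P.L : ℕ) : ℝ) ^ 2 * θ₀) + 11000000 * βs) * β Q +
          5 * (P.L : ℝ) ^ 3 * θ₀ * ∑ c ∈ Finset.univ.filter (fun c : PBond P j => ∀ κ, blockOf c.src κ = Q.src κ ∨ blockOf c.src κ = Q.src κ + 1),
            dist1 (bdev U U₀ c))) ∧
    √(∑ Q : Plaq P (j + 1), ((1500000 * ((((P.d + 2) * P.L : ℕ) : ℝ) ^ 2 * θ₀) + 11000000 * βs) * β Q +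
          5 * (P.L : ℝ) ^ 3 * θ₀ * ∑ c ∈ Finset.univ.filter (fun c : PBond P j => ∀ κ, blockOf c.src κ = Q.src κ ∨ blockOf c.src κ = Q.src κ + 1),
            dist1 (bdev U U₀ c)) ^ 2) ≤
      (1500000 * ((((P.d + 2) * P.L : ℕ) : ℝ) ^ 2 * θ₀) + 11000000 * βs) * cε * √(((3 ^ P.d * P.L ^ P.d * P.d ^ 2 : ℕ) : ℝ) * ((3 ^ P.d * P.d ^ 2 : ℕ) : ℝ)) *
          √(∑ q : Plaq P j, dist1 ((GaugeField.plaqHol U₀ q)⁻¹ * GaugeField.plaqHol U q) ^ 2) +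
      ((1500000 * ((((P.d + 2) * P.L : ℕ) : ℝ) ^ 2 * θ₀) + 11000000 * βs) * cβ + 5 * (P.L : ℝ) ^ 3 * θ₀) *
        √(((3 ^ P.d * P.L ^ P.d * P.d : ℕ) : ℝ) * ((3 ^ P.d * P.d ^ 2 : ℕ) : ℝ)) * √(∑ c : PBond P j, dist1 (bdev U U₀ c) ^ 2) := by
  classical
  set T₀ : ℝ := (((P.d + 2) * P.L : ℕ) : ℝ) ^ 2 * θ₀ with hT₀
  have hT0 : 0 ≤ T₀ := by positivity
  have hL3 : 0 ≤ (P.L : ℝ) ^ 3 * θ₀ := by positivity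
  set κ : ℝ := 1500000 * T₀ + 11000000 * βs with hκ
  -- the per-Q forward-near and 3-near sums of `g`
  set g : PBond P j → ℝ := fun c => dist1 (bdev U U₀ c) with hg
  have hg0 : ∀ c, 0 ≤ g c := fun c => GaugeGroup.dist1_nonneg _
  set N2 : Plaq P (j + 1) → ℝ := fun Q => ∑ c ∈ Finset.univ.filter (fun c : PBond P j => ∀ κ, blockOf c.src κ = Q.src κ ∨ blockOf c.src κ = Q.src κ + 1), g c with hN2
  set N3 : Plaq P (j + 1) → ℝ := fun Q => ∑ c ∈ Finset.univ.filter (fun c : PBond P j => ∀ κ, blockOf c.src κ = Q.src κ ∨ blockOf c.src κ = Q.src κ + 1 ∨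
      blockOf c.src κ = Q.src κ - 1), g c with hN3
  have hN2le : ∀ Q, N2 Q ≤ N3 Q := fun Q => by
    refine Finset.sum_le_sum_of_subset_of_nonneg (fun c hc => ?_) (fun c _ _ => hg0 c)
    rw [Finset.mem_filter] at hc ⊢
    exact ⟨hc.1, fun κ => (hc.2 κ).elim Or.inl (fun h => Or.inr (Or.inl h))⟩
  have hN20 : ∀ Q, 0 ≤ N2 Q := fun Q => Finset.sum_nonneg fun c _ => hg0 c
  refine ⟨fun Q => ?_, ?_⟩
  · -- (hstep): ✓`relOneLevelStep_bkg` with `β := β Q`, `γ := Σ over forward-near bonds = N2 Q`; then `β Q² ≤ β♯·β Q`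
    have h := relOneLevelStep_bkg hj U U₀ hθ00 hθ₀θ hθ hδ hU hU₀ Q (hβ0 Q) ((hβsup Q).trans hβs) (hW Q) (hA Q) (hS Q) (γ := N2 Q)
      (fun c hc => Finset.single_le_sum (f := g) (fun c' _ => hg0 c') (Finset.mem_filter.mpr ⟨Finset.mem_univ c, hc⟩))
    have hsq : β Q ^ 2 ≤ βs * β Q := by rw [sq]; exact mul_le_mul_of_nonneg_right (hβsup Q) (hβ0 Q)
    rw [hκ, hT₀]
    linarith only [h, hsq]
  · -- (hj): `j Q ≤ A·N3 Q + B·M3 Q` (`A = 1.5e6·T·cβ + 5L³θ`, `B = 1.5e6·T·cε`), Minkowski, then the two Schur bounds (bonds: §1; plaquettes: ✓p817170)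
    set fδ : Plaq P j → ℝ := fun q => dist1 ((GaugeField.plaqHol U₀ q)⁻¹ * GaugeField.plaqHol U q) with hfδ
    have hfδ0 : ∀ q, 0 ≤ fδ q := fun q => GaugeGroup.dist1_nonneg _
    set M3 : Plaq P (j + 1) → ℝ := fun Q => ∑ q ∈ Finset.univ.filter (fun q : Plaq P j => ∀ κ, blockOf q.src κ = Q.src κ ∨ blockOf q.src κ = Q.src κ + 1 ∨
        blockOf q.src κ = Q.src κ - 1), fδ q with hM3
    have hM30 : ∀ Q, 0 ≤ M3 Q := fun Q => Finset.sum_nonneg fun q _ => hfδ0 q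
    have hN30 : ∀ Q, 0 ≤ N3 Q := fun Q => Finset.sum_nonneg fun c _ => hg0 c
    have hκ0 : 0 ≤ κ := by positivity
    set A : ℝ := κ * cβ + 5 * (P.L : ℝ) ^ 3 * θ₀ with hA
    set B : ℝ := κ * cε with hB
    have hA0 : 0 ≤ A := by positivity
    have hB0 : 0 ≤ B := by positivity
    have hjQ : ∀ Q, κ * β Q + 5 * (P.L : ℝ) ^ 3 * θ₀ * N2 Q ≤ A * N3 Q + B * M3 Q := fun Q => by
      have h1 := mul_le_mul_of_nonneg_left (hβ Q) hκ0
      have h2 := mul_le_mul_of_nonneg_left (hN2le Q) hL3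
      calc κ * β Q + 5 * (P.L : ℝ) ^ 3 * θ₀ * N2 Q ≤ κ * (cβ * N3 Q + cε * M3 Q) + 5 * ((P.L : ℝ) ^ 3 * θ₀) * N3 Q := by linarith
        _ = A * N3 Q + B * M3 Q := by rw [hA, hB]; ring
    have hj0 : ∀ Q, 0 ≤ κ * β Q + 5 * (P.L : ℝ) ^ 3 * θ₀ * N2 Q := fun Q => by
      have := hβ0 Q; have := hN20 Q; positivity
    -- Minkowski: `√Σ j² ≤ √Σ (A·N3)² + √Σ (B·M3)²`
    have hMink := FluctuationComparisonRegPrIntLS2BetaKeyLemmaSkeleton.sqrt_sum_sq_le_of_le_add Finset.univ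
      (fun Q => κ * β Q + 5 * (P.L : ℝ) ^ 3 * θ₀ * N2 Q) (fun Q => A * N3 Q) (fun Q => B * M3 Q) (fun Q _ => hj0 Q) (fun Q _ => hjQ Q)
    -- Schur, bonds
    have hb1 : ∑ Q : Plaq P (j + 1), (A * N3 Q) ^ 2 = A ^ 2 * ∑ Q : Plaq P (j + 1), (N3 Q) ^ 2 := by
      rw [Finset.mul_sum]; exact Finset.sum_congr rfl fun Q _ => by ring
    have hb2 := fineBond_nbhd3_schur hj g
    have hSb : √(∑ Q : Plaq P (j + 1), (A * N3 Q) ^ 2) ≤ A * √(((3 ^ P.d * P.L ^ P.d * P.d : ℕ) : ℝ) * ((3 ^ P.d * P.d ^ 2 : ℕ) : ℝ)) * √(∑ c : PBond P j, g c ^ 2) := by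
      rw [hb1]
      calc √(A ^ 2 * ∑ Q : Plaq P (j + 1), (N3 Q) ^ 2) ≤ √(A ^ 2 * ((((3 ^ P.d * P.L ^ P.d * P.d : ℕ) : ℝ) * ((3 ^ P.d * P.d ^ 2 : ℕ) : ℝ)) * ∑ c : PBond P j, g c ^ 2)) :=
            Real.sqrt_le_sqrt (mul_le_mul_of_nonneg_left hb2 (sq_nonneg _))
        _ = A * √(((3 ^ P.d * P.L ^ P.d * P.d : ℕ) : ℝ) * ((3 ^ P.d * P.d ^ 2 : ℕ) : ℝ)) * √(∑ c : PBond P j, g c ^ 2) := by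
            rw [Real.sqrt_mul (sq_nonneg _), Real.sqrt_sq hA0, Real.sqrt_mul (by positivity)]; ring
    -- Schur, plaquettes (✓p817170 `nbhd_schur`)
    have hp1 : ∑ Q : Plaq P (j + 1), (B * M3 Q) ^ 2 = B ^ 2 * ∑ Q : Plaq P (j + 1), (M3 Q) ^ 2 := by
      rw [Finset.mul_sum]; exact Finset.sum_congr rfl fun Q _ => by ring
    have hp2 := FluctuationComparisonRegPrIntLS2BetaNeighbourhoodKernelTorus.nbhd_schur hj fδ
    have hSp : √(∑ Q : Plaq P (j + 1), (B * M3 Q) ^ 2) ≤ B * √(((3 ^ P.d * P.L ^ P.d * P.d ^ 2 : ℕ) : ℝ) * ((3 ^ P.d * P.d ^ 2 : ℕ) : ℝ)) * √(∑ q : Plaq P j, fδ q ^ 2) := by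
      rw [hp1]
      calc √(B ^ 2 * ∑ Q : Plaq P (j + 1), (M3 Q) ^ 2) ≤ √(B ^ 2 * ((((3 ^ P.d * P.L ^ P.d * P.d ^ 2 : ℕ) : ℝ) * ((3 ^ P.d * P.d ^ 2 : ℕ) : ℝ)) * ∑ q : Plaq P j, fδ q ^ 2)) :=
            Real.sqrt_le_sqrt (mul_le_mul_of_nonneg_left hp2 (sq_nonneg _))
        _ = B * √(((3 ^ P.d * P.L ^ P.d * P.d ^ 2 : ℕ) : ℝ) * ((3 ^ P.d * P.d ^ 2 : ℕ) : ℝ)) * √(∑ q : Plaq P j, fδ q ^ 2) := by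
            rw [Real.sqrt_mul (sq_nonneg _), Real.sqrt_sq hB0, Real.sqrt_mul (by positivity)]; ring
    have hfin := hMink.trans (add_le_add hSb hSp)
    rw [hA, hB, hκ, hT₀] at hfin
    linarith [hfin]

end Summit.QuantumFields.YangMills.Theorems.FluctuationComparisonRegPrIntLS2BetaRelativeHstepHjBkg

end
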